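import Literature.AnabelianGeometry.EtaleTheta.Discharge.Sec3BLambdaInjectiveOfGaloisCoveringConnected
import Literature.AnabelianGeometry.EtaleTheta.Discharge.Sec3Prop34iConnectedOfGaloisCovering
import HarnessLib

/-!
# [EtTh] Def 3.6 (i) "`Φ₀^ℝ := Φ₀^rlf`, a monoid on `D₀`" over the WEAK vocabulary: [FrdI] row P53/L02a
# ("the divisor monoid `Φ^rlf`") for weakly perf-factorial values, and the instances at the constructed connected data

S. Mochizuki, *The geometry of Frobenioids I*, Kyushu J. Math. **62** (2008), Def. 1.1 (ii) p. 19 (a monoid on `D`: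
pull-backs characteristically injective, bijective along FSM-morphisms), Def. 2.4 (i) p. 48 (`M^rlf`), Prop. 5.3 p. 103
("the divisor monoid `Φ^rlf`", "the rational function monoid `ℝ·Φ^birat`") [cite: MochizukiFrdI2008, Prop. 5.3 p.103];
S. Mochizuki, *The étale theta function …*, Publ. RIMS **45** (2009) [MochizukiEtTh2009], Def. 3.6 (i) PDF p. 76
("`Φ₀^ℝ := Φ₀^rlf` …; `B₀^Λ` for … `ℝ·Φ₀^birat` if `Λ = ℝ`" — both as monoids on `D₀`) [cite: MochizukiEtTh2009, Def 3.6 p.76].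

abc-iut cell, block C / W6, seat abc-iut-w6-d048 (gen 3; row family R227 «§3 weak column at `Λ = ℝ`»).  PROOF-ONLY
(0 definitions, 0 `Prop` facts, 0 instances).  abc-iut-w5-d137 / abc-iut-L1-d2's `RealificationMonoidOn.lean` proves, for
the STRONG vocabulary, that `Φ^rlf` is a monoid on `D` when `Φ` is a perf-factorial monoid on `D` whose pull-backs
REFLECT divisibility (`isMonoidOn_rlfFunctor_of_reflects`; false without reflection, P53-F1).  At the [EtTh] data of
record the values `Φ₀(Y)` are only WEAKLY perf-factorial with cofinal perfection (F-L2d2-1, F-L2d2-2; abc-iut-L6-t12's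
`rlfFunctorWeak`, `ofRlfZWeak` / `ofRlfRWeak`), for which that theorem says nothing.  This file supplies the weak twin
and applies it:
* §1 `rlfMapWeak_bijective_of_bijective` — `Φ(f)` bijective ⇒ `Φ(f)^rlf` bijective (two-sided inverse from the weak
  universal property along `Φ(f)⁻¹`, abc-iut-L2-d2's `RlfUniversalWeak.existsUnique_map` / `map_id`);
  **`isMonoidOn_rlfFunctorWeak_of_reflects`** — [FrdI] P53/L02a over `IsPerfFactorialCof`: `Φ^rlf` IS a monoid on `D` for
  a monoid `Φ` on `D` with divisibility-reflecting pull-backs (injectivity: `rlfMapWeak_injective_of_reflects`, same seat,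
  `Sec3BLambdaInjectiveOfRlfRWeakReflects.lean`; characteristic injectivity since `M^rlf` is sharp; FSM-bijectivity by
  functoriality).
* §2 at [EtTh] Def. 3.6 (i): `RealifiedDivisorMonoids.isMonoidOn_ΦR_ofRlfRWeak_of_reflects` / `…_ofRlfZWeak_of_reflects`
  — "`Φ₀^ℝ` is a monoid on `D₀`" for the weak constructed data, from "`Φ₀` is a monoid on `D₀`" (Prop. 3.4 (i)) +
  `hΦrefl`; and UNCONDITIONALLY at abc-iut-w6-d058's constructed connected data
  (`isMonoidOn_ΦR_ofRlfRWeak_ofGaloisActionConnected` / `…_ofRlfZWeak_…`: their `DivisorMonoids.isMonoidOn_ofGaloisActionConnected`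
  + my `ofGaloisActionConnected_Φ₀_map_reflects_dvd`).
HONEST FRAMING: refereed pre-IUT material ([FrdI] 2008, [EtTh] 2009); constructions over typed interfaces
(`LogDivisorModel` / `GaloisAction`: nothing asserts they arise from a curve); nothing here bears on [IUTchIII] Cor. 3.12;
no side taken; typed ≠ proved for anything else.
-/

noncomputable section

namespace Literature.AnabelianGeometry.EtaleTheta

open CategoryTheory Opposite Function Literature.AlgebraicGeometry.Frobenioids

universe u₀ v₀ u v w

/-! ### §1 [FrdI] P53/L02a over the weak vocabulary -/

section RlfFunctorWeak

variable {J : Type u} [Category.{v} J] (Φ : J ⥤ CommMonCat.{w}) (hΦ : ∀ j : J, IsPerfFactorialCof (Φ.obj j))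

/-- **`Φ(f)` bijective ⇒ `Φ(f)^rlf` bijective** (weak vocabulary): the homomorphism over `(Φ(f)⁻¹)^pf` furnished by the
weak universal property is a two-sided inverse, by uniqueness over `id^pf`. [cite: MochizukiFrdI2008, Prop. 5.3 p.103] -/
theorem rlfMapWeak_bijective_of_bijective {j j' : J} (f : j ⟶ j') (hf : Bijective (Φ.map f).hom) :
    Bijective (rlfMapWeak Φ hΦ f) := by
  let e : Φ.obj j ≃* Φ.obj j' := MulEquiv.ofBijective (Φ.map f).hom hf
  obtain ⟨Gm, hGm, -⟩ := RlfUniversalWeak.existsUnique_map (hΦ j').weak (hΦ j').rlfCofinal (hΦ j).weak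
    (hΦ j).weak.supports_rlf_R e.symm.toMonoidHom
  have hsf : e.symm.toMonoidHom.comp (Φ.map f).hom = MonoidHom.id _ :=
    MonoidHom.ext fun x => e.symm_apply_apply x
  have hfs : (Φ.map f).hom.comp e.symm.toMonoidHom = MonoidHom.id _ :=
    MonoidHom.ext fun y => e.apply_symm_apply y
  have h1 : Gm.comp (rlfMapWeak Φ hΦ f) = MonoidHom.id _ := by
    apply RlfUniversalWeak.map_id (hΦ j).weak (hΦ j).rlfCofinal (hΦ j).weak.supports_rlf_R
    rw [MonoidHom.comp_assoc, rlfMapWeak_comp_toRealification, ← MonoidHom.comp_assoc, hGm, MonoidHom.comp_assoc,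
      ← Perfection.map_comp, hsf]
  have h2 : (rlfMapWeak Φ hΦ f).comp Gm = MonoidHom.id _ := by
    apply RlfUniversalWeak.map_id (hΦ j').weak (hΦ j').rlfCofinal (hΦ j').weak.supports_rlf_R
    rw [MonoidHom.comp_assoc, hGm, ← MonoidHom.comp_assoc, rlfMapWeak_comp_toRealification, MonoidHom.comp_assoc,
      ← Perfection.map_comp, hfs]
  exact ⟨LeftInverse.injective (g := Gm) fun x => DFunLike.congr_fun h1 x,
    RightInverse.surjective (g := Gm) fun y => DFunLike.congr_fun h2 y⟩

end RlfFunctorWeak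

section OnD

variable {D : Type u} [Category.{v} D] {Φ : Dᵒᵖ ⥤ CommMonCat.{w}}

/-- **[FrdI] Prop. 5.3, "the divisor monoid `Φ^rlf`" (row P53/L02a), over the WEAK vocabulary**: if `Φ` is a monoid on
`D` with weakly perf-factorial values (cofinal perfection) whose pull-back maps REFLECT divisibility, then
`Φ^rlf = rlfFunctorWeak Φ hΦ` is a monoid on `D` — pull-backs injective by `rlfMapWeak_injective_of_reflects`, injective on
characteristics since `M^rlf` is sharp, bijective along FSM-morphisms by `rlfMapWeak_bijective_of_bijective`.
(Without reflection: FALSE, finding P53-F1.) [cite: MochizukiFrdI2008, Prop. 5.3 p.103] -/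
theorem isMonoidOn_rlfFunctorWeak_of_reflects (hΦ : ∀ X : Dᵒᵖ, IsPerfFactorialCof (Φ.obj X)) (hM : IsMonoidOn Φ)
    (hrefl : ∀ ⦃A B : D⦄ (α : B ⟶ A) (a b : Φ.obj (op A)), pull Φ α a ∣ pull Φ α b → a ∣ b) :
    IsMonoidOn (rlfFunctorWeak Φ hΦ) := by
  refine ⟨fun {A B} α => ?_, fun {A B} α hα => ?_⟩
  · have hinj : Injective (pull (rlfFunctorWeak Φ hΦ) α) := by
      change Injective (rlfMapWeak Φ hΦ α.op)
      exact rlfMapWeak_injective_of_reflects Φ hΦ α.op (hM.isCharInjective α).1 (hrefl α)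
    exact ⟨hinj, associatesMap_injective_of_isSharp (IsPerfFactorialWeak.Rlf.isSharp (hΦ (op B)).weak) hinj⟩
  · change Bijective (rlfMapWeak Φ hΦ α.op)
    exact rlfMapWeak_bijective_of_bijective Φ hΦ α.op (hM.bijective_of_isFSM α hα)

end OnD

/-! ### §2 [EtTh] Def. 3.6 (i): "`Φ₀^ℝ` is a monoid on `D₀`" for the weak constructed data -/

namespace RealifiedDivisorMonoids

section Abstract

variable {D₀ : Type u₀} [Category.{v₀} D₀] (dm : DivisorMonoids.{u₀, v₀, w} D₀)
  (hpf : ∀ Y : D₀ᵒᵖ, IsPerfFactorialCof (dm.Φ₀.obj Y))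

/-- **Def. 3.6 (i): `Φ₀^ℝ := Φ₀^rlf` of `ofRlfRWeak dm hpf` IS a monoid on `D₀`** when `Φ₀` is (Prop. 3.4 (i): "the functor
`Φ₀` defines a divisorial monoid on `D₀`") and its pull-backs reflect divisibility. [cite: MochizukiEtTh2009, Def 3.6 p.76] -/
theorem isMonoidOn_ΦR_ofRlfRWeak_of_reflects (hΦmon : IsMonoidOn dm.Φ₀)
    (hΦrefl : ∀ {Y Y' : D₀ᵒᵖ} (g : Y ⟶ Y') (a b : dm.Φ₀.obj Y),
      (dm.Φ₀.map g).hom a ∣ (dm.Φ₀.map g).hom b → a ∣ b) :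
    IsMonoidOn (ofRlfRWeak dm hpf).ΦR :=
  isMonoidOn_rlfFunctorWeak_of_reflects hpf hΦmon fun _ _ α a b h => hΦrefl α.op a b h

/-- The same for the `Λ = ℤ` data `ofRlfZWeak dm hpf` (same `Φ₀^ℝ`). [cite: MochizukiEtTh2009, Def 3.6 p.76] -/
theorem isMonoidOn_ΦR_ofRlfZWeak_of_reflects (hΦmon : IsMonoidOn dm.Φ₀)
    (hΦrefl : ∀ {Y Y' : D₀ᵒᵖ} (g : Y ⟶ Y') (a b : dm.Φ₀.obj Y),
      (dm.Φ₀.map g).hom a ∣ (dm.Φ₀.map g).hom b → a ∣ b) :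
    IsMonoidOn (ofRlfZWeak dm hpf).ΦR :=
  isMonoidOn_rlfFunctorWeak_of_reflects hpf hΦmon fun _ _ α a b h => hΦrefl α.op a b h

end Abstract

section Connected

open LogDivisorModel.GaloisAction

variable {Z : LogDivisorModel.{u}} {G : Type u} [Group G] (A : Z.GaloisAction G) (hZ : Z.CuspLaws)
  (hpf : ∀ Y : ((isConnectedGSet (G := G)).FullSubcategory)ᵒᵖ,
    IsPerfFactorialCof ((DivisorMonoids.ofGaloisActionConnected A hZ).Φ₀.obj Y))

/-- **`Φ₀^ℝ` IS a monoid on `D₀` — UNCONDITIONALLY at the constructed connected data**, `Λ = ℝ` constructor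
(abc-iut-w6-d058's `DivisorMonoids.isMonoidOn_ofGaloisActionConnected` + divisibility reflection
`ofGaloisActionConnected_Φ₀_map_reflects_dvd`). [cite: MochizukiEtTh2009, Def 3.6 p.76] -/
theorem isMonoidOn_ΦR_ofRlfRWeak_ofGaloisActionConnected :
    IsMonoidOn (ofRlfRWeak (DivisorMonoids.ofGaloisActionConnected A hZ) hpf).ΦR :=
  isMonoidOn_ΦR_ofRlfRWeak_of_reflects _ hpf (DivisorMonoids.isMonoidOn_ofGaloisActionConnected A hZ)
    fun g a b h => DivisorMonoids.ofGaloisActionConnected_Φ₀_map_reflects_dvd A hZ g a b h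

/-- The same for the `Λ = ℤ` constructor at the connected data (the data of record of §§4–5).
[cite: MochizukiEtTh2009, Def 3.6 p.76] -/
theorem isMonoidOn_ΦR_ofRlfZWeak_ofGaloisActionConnected :
    IsMonoidOn (ofRlfZWeak (DivisorMonoids.ofGaloisActionConnected A hZ) hpf).ΦR :=
  isMonoidOn_ΦR_ofRlfZWeak_of_reflects _ hpf (DivisorMonoids.isMonoidOn_ofGaloisActionConnected A hZ)
    fun g a b h => DivisorMonoids.ofGaloisActionConnected_Φ₀_map_reflects_dvd A hZ g a b h

end Connected

end RealifiedDivisorMonoids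

end Literature.AnabelianGeometry.EtaleTheta

end
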